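import Summits.BirchSwinnertonDyer.BirchSwinnertonDyer.Theorems.AlignedTransportAtTwoMainConjectureOfRankZeroBSDAtTwoCubicOrderFourRowN12163Certs
import HarnessLib

/-!
# Route `AlignedTransportAtTwo`, crux C2 `MainConjectureOfRankZeroBSDAtTwo` (stmt-BirchSwinnertonDyer-22298):
# `e₁ = ord₂ h(ℚ(β,√2)) ≥ 2` IN THE KERNEL for the cubic `2`-torsion field of `⟨1, 1, 1, -4, -8⟩` (`N = 12163`, `t = 3`, regime (β)) —
# the ORDER-FOUR CERTIFICATE decided in `ℤ[θ]`: three units of `ℚ(β,√2)` modulo `±` squares, the prime `(q₀, √2 − 3)` above `7` of order `4`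

HONEST FRAMING (cell `bsd-f1-sign2`, WIDTH-5 attached prover seat `bsd-line-att-p4` gen 40 on line `birth` of the lead `bsd-line-att-p2`;
`--supports` stmt-BirchSwinnertonDyer-22298, closes nothing; BSD is NOT proved by any of this; the crux C2, its verdict «blocked-on
`Rank1Residual.GreenbergMuConjectureIrreducible`» and every registered stub are untouched).  THEOREMS ONLY (no `def`, no named fact, no instance, no `sorry`).

WHAT.  `W = ⟨1, 1, 1, -4, -8⟩` (`Δ_min = −12163` prime, `≡ 5 (mod 8)`, rank `0`) is the hard-core seed of the u7 sub-cell with `t = 3` (`σ₁(ε) ≡ ±7 (mod 16)`),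
genus regime (β) and — census-grade until now (att-p4 g39 memo `DEPTH-DOOR-CUSTOMERS` §2, §2b: `Cl(K₁) ≅ ℤ/4`) — `e₁ ≥ 2`, the displayed per-seed input of
att-p3 g46's PRO-CYCLIC DOOR (`t = 3 ∧ e₁ ≥ 2 ⟹ μ₂ = 0, λ₂ ≤ 1`).  This file makes `e₁ ≥ 2` a KERNEL theorem via this seat's order-four door
(`…CubicOrderFourDoor`, Literature `NumberFields/QuadraticSqrtTwoClassNumberDvdFourCertificate`, `IwasawaTheory/ClassNumberPExpLayerOneGeTwoOfOrderFourCertificate`)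
with every datum decided in `𝓞_{ℚ(β)} = ℤ[θ]` (`θ = (60 − u − u²)/16`, `u = 4β`, `f = X³ − 3X² + 7X + 16`; att-p4 g38 `…CubicDoorsDeadSubcellClassNumberF` /
`CubicDisc12163`): with `s = √2 ∈ K₁ = ℚ(β, s)`,
* three UNITS of `K₁`: `u₁ = ε⁻¹ = −60233 − 36572θ + 8142θ²` (inverse `ε = 17464080455 − 5988261880θ + 1398665746θ²`), `u₂ = 1 + s` (inverse `−1 + s`),
  `u₃ = (−3 − 6θ − 30θ²) + (38 − 18θ − 18θ²)s` (relative norm `1`; inverse its conjugate);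
* the split prime `𝔮 = (q₀)`, `q₀ = 1035 + 677θ − 102θ²` of norm `7` (`θ ≡ 1`), the prime `𝔔 = (q₀, s − 3)` of `K₁` above it, and `w = A + Bs`,
  `A = 1517 + 2118θ + 729θ²`, `B = 1128 − 610θ − 1163θ²` with `(w) = 𝔔⁴` — certified by the ideal identities `(q₀, s − 3)² = (w, q₀²)` and `(w, q₀²)² = (w)`
  (ring witnesses in `ℤ[θ][s]`, found by lattice reduction; `N_{K₁/ℚ(β)}(w) = −ε q₀⁴`);
* `31` RESIDUE CERTIFICATES at the split primes above `7` (`θ ≡ 1`, `s ≡ ±3`) and `31` (`θ ≡ 15, 23, 27`, `s ≡ ±8`): for every `(e₁,e₂,e₃,e₄,±) ≠ (0,0,0,0,+)`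
  the element `±u₁^{e₁}u₂^{e₂}u₃^{e₃}w^{e₄}` is a non-square modulo one of them — so (Dirichlet: `rank E_{K₁} = 3`, `√−1 ∉ K₁`) `(w, q₀²) = 𝔔²` is NOT
  principal, `[𝔔]` has order `4`, `4 ∣ h(K₁)`.
THEN (★ `two_le_classNumberPExp_one_cubicField_n12163`, THIS FILE, part 3 of 3; data in `…RowN12163Data`, certificates in `…RowN12163Certs`) `e₁(κ) ≥ 2` for every
cyclotomic `ℤ₂`-extension `κ` of `ℚ(β)` — UNCONDITIONAL.
Numerics behind the data (pure python, seat folder `tools/cert12163.py`, `tools/o4rel.py`; every identity re-verified exactly and, here, by the kernel):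
the S-unit relation lattice of `K₁` over `{𝔓₁, 𝔓₂} ∪ {primes over 7, 31, 41, 47, 73}` has determinant `4` (`h(K₁) = 4`, heuristic), consistent with
`e₁ = 2` exactly.  Nothing is asserted about `μ₂` or `MC₂` for this curve; BSD is NOT proved; nothing is closed.

References: [NeukirchANT1999] I §3, §7 (7.4), §8; [Cohen1993] §4.7, §6.5, Prop. 4.8.11; [Marcus2018] Ch. 3 Thm. 27; [Washington1997] §13.1;
[LMFDB] nf 3.1.12163.1, ec 12163; tree: this seat's `…CubicOrderFourDoor`, att-p4 g38 `…CubicDoorsDeadSubcellClassNumberF`,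
`Literature/NumberTheory/CubicFields/CubicFieldDiscriminant12163*`, `MonicCubic.exists_ringHom_of_root`.
-/

set_option linter.dupNamespace false
set_option autoImplicit false

noncomputable section

open scoped Classical NumberField nonZeroDivisors IntermediateField

namespace Summit.BirchSwinnertonDyer.BirchSwinnertonDyer.Theorems.AlignedTransportAtTwoCubicOrderFourRowN12163

open NumberField IsDedekindDomain Polynomial WeierstrassCurve IntermediateField CongruenceSubgroup Module
  Literature.NumberTheory.IwasawaTheory Literature.NumberTheory.GaloisRepresentations
  Literature.NumberTheory.EllipticCurves Literature.NumberTheory.EllipticCurves.Greenberg1999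
  Literature.NumberTheory.EllipticCurves.ModularForms Literature.NumberTheory.EllipticCurves.Rank1Residual
  Literature.NumberTheory.EllipticCurves.Module
  Literature.NumberTheory.NumberFields Literature.NumberTheory.CubicFields
  Summit.BirchSwinnertonDyer.Rank1Residual Summit.BirchSwinnertonDyer.Rank1Residual.X1.MuLambda
  Summit.BirchSwinnertonDyer.Rank1Residual.X5 Summit.BirchSwinnertonDyer.Rank1Residual.X5.O1
  Summit.BirchSwinnertonDyer.Rank1Residual.X5.Instances Summit.BirchSwinnertonDyer.Rank1Residual.F1Sign2
  Summit.BirchSwinnertonDyer.BirchSwinnertonDyer.Theorems.Rank1ResidualX1Defs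
  Summit.BirchSwinnertonDyer.BirchSwinnertonDyer.Theses.AlignedTransportAtTwo
  Summit.BirchSwinnertonDyer.BirchSwinnertonDyer.Theorems.AlignedTransportAtTwoCubicOrderFourDoor
  Summit.BirchSwinnertonDyer.BirchSwinnertonDyer.Theorems.AlignedTransportAtTwoCubicDoorsDeadSubcellClassNumberF

/-! ## `e₁ ≥ 2` for the cubic field of discriminant `−12163` — UNCONDITIONAL -/

/-- ★ **`e₁ = ord₂ h(ℚ(β,√2)) ≥ 2`** for the cubic `2`-torsion field of `⟨1,1,1,−4,−8⟩` (discriminant `−12163`) and every cyclotomic `ℤ₂`-extension `κ`: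
the order-four certificate (three units modulo `±` squares by `31` residue certificates, the prime `(q₀, √2 − 3)` above `7` of order `4`) decided in
`ℤ[θ]` and `ℤ/7`, `ℤ/31`. [cite: NeukirchANT1999, Ch. I §7 Thm. (7.4), Ch. I §3, Ch. I §8] [cite: Cohen1993, §6.5]
[cite: LMFDB, number field 3.1.12163.1 (class number 1); elliptic curve 12163 (conductor 12163)] [cite: Marcus2018, Ch. 3, Thm. 27] -/
theorem two_le_classNumberPExp_one_cubicField_n12163 {β : AlgebraicClosure ℚ} (hβ : aeval β ((⟨1, 1, 1, -4, -8⟩ : WeierstrassCurve ℤ).baseChange ℚ).twoTorsionPolynomial.toPoly = 0)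
    (κP : ZpExtension ↥(IntermediateField.adjoin ℚ ({β} : Set (AlgebraicClosure ℚ))) 2) (hκP : κP.IsCyclotomic) :
    2 ≤ classNumberPExp κP 1 := by
  haveI := isElliptic_n12163
  haveI : FiniteDimensional ℚ ↥(IntermediateField.adjoin ℚ ({β} : Set (AlgebraicClosure ℚ))) := IntermediateField.adjoin.finiteDimensional ((AlgebraicClosure.isAlgebraic ℚ).isAlgebraic β).isIntegral
  haveI : NumberField ↥(IntermediateField.adjoin ℚ ({β} : Set (AlgebraicClosure ℚ))) := NumberField.mk
  have hd : ¬ (2 : ℤ) ∣ NumberField.discr ↥(IntermediateField.adjoin ℚ ({β} : Set (AlgebraicClosure ℚ))) := by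
    rw [CubicDisc12163.discr_eq (finrank_cubicField_n12163 hβ) (aeval_theta_n12163 hβ)]; norm_num
  set θI : 𝓞 ↥(IntermediateField.adjoin ℚ ({β} : Set (AlgebraicClosure ℚ))) := MonicCubic.thetaInt (aeval_theta_n12163 hβ) with hθI
  have hcert : ∀ (e₁ e₂ e₃ e₄ : ℕ) (σ : ℤˣ), e₁ ≤ 1 → e₂ ≤ 1 → e₃ ≤ 1 → e₄ ≤ 1 →
      ¬ (e₁ = 0 ∧ e₂ = 0 ∧ e₃ = 0 ∧ e₄ = 0 ∧ σ = 1) →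
      ∃ (q : ℕ) (ψ : 𝓞 ↥(IntermediateField.adjoin ℚ ({β} : Set (AlgebraicClosure ℚ))) →+* ZMod q) (t : ZMod q) (ρ : 𝓞 ↥(IntermediateField.adjoin ℚ ({β} : Set (AlgebraicClosure ℚ)))), 2 * t = 1 ∧ ψ ρ ^ 2 = 2 ∧
        ¬ IsSquare (((σ : ℤ) : ZMod q) * (ψ ((-60233 : 𝓞 ↥(IntermediateField.adjoin ℚ ({β} : Set (AlgebraicClosure ℚ)))) + (-36572 : 𝓞 ↥(IntermediateField.adjoin ℚ ({β} : Set (AlgebraicClosure ℚ)))) * θI + (8142 : 𝓞 ↥(IntermediateField.adjoin ℚ ({β} : Set (AlgebraicClosure ℚ)))) * θI ^ 2) + ψ ((0 : 𝓞 ↥(IntermediateField.adjoin ℚ ({β} : Set (AlgebraicClosure ℚ)))) + (0 : 𝓞 ↥(IntermediateField.adjoin ℚ ({β} : Set (AlgebraicClosure ℚ)))) * θI + (0 : 𝓞 ↥(IntermediateField.adjoin ℚ ({β} : Set (AlgebraicClosure ℚ)))) * θI ^ 2) * ψ ρ) ^ e₁ * (ψ ((1 : 𝓞 ↥(IntermediateField.adjoin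 ℚ ({β} : Set (AlgebraicClosure ℚ)))) + (0 : 𝓞 ↥(IntermediateField.adjoin ℚ ({β} : Set (AlgebraicClosure ℚ)))) * θI + (0 : 𝓞 ↥(IntermediateField.adjoin ℚ ({β} : Set (AlgebraicClosure ℚ)))) * θI ^ 2) + ψ ((1 : 𝓞 ↥(IntermediateField.adjoin ℚ ({β} : Set (AlgebraicClosure ℚ)))) + (0 : 𝓞 ↥(IntermediateField.adjoin ℚ ({β} : Set (AlgebraicClosure ℚ)))) * θI + (0 : 𝓞 ↥(IntermediateField.adjoin ℚ ({β} : Set (AlgebraicClosure ℚ)))) * θI ^ 2) * ψ ρ) ^ e₂ * (ψ ((-3 : 𝓞 ↥(IntermediateField.adjoin ℚ ({β} : Set (AlgebraicClosure ℚ)))) + (-6 : 𝓞 ↥(IntermediateField.adjoin ℚ ({β} : Set (AlgebraicClosure ℚ)))) * θI + (-30 : 𝓞 ↥(IntermediateField.adjoin ℚ ({β} : Set (AlgebraicClosure ℚ)))) * θI ^ 2) + ψ ((38 : 𝓞 ↥(IntermediateField.adjoin ℚ ({β} : Set (AlgebraicClosure ℚ)))) + (-18 : 𝓞 ↥(IntermediateField.adjoin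 ℚ ({β} : Set (AlgebraicClosure ℚ)))) * θI + (-18 : 𝓞 ↥(IntermediateField.adjoin ℚ ({β} : Set (AlgebraicClosure ℚ)))) * θI ^ 2) * ψ ρ) ^ e₃ * (ψ ((1517 : 𝓞 ↥(IntermediateField.adjoin ℚ ({β} : Set (AlgebraicClosure ℚ)))) + (2118 : 𝓞 ↥(IntermediateField.adjoin ℚ ({β} : Set (AlgebraicClosure ℚ)))) * θI + (729 : 𝓞 ↥(IntermediateField.adjoin ℚ ({β} : Set (AlgebraicClosure ℚ)))) * θI ^ 2) + ψ ((1128 : 𝓞 ↥(IntermediateField.adjoin ℚ ({β} : Set (AlgebraicClosure ℚ)))) + (-610 : 𝓞 ↥(IntermediateField.adjoin ℚ ({β} : Set (AlgebraicClosure ℚ)))) * θI + (-1163 : 𝓞 ↥(IntermediateField.adjoin ℚ ({β} : Set (AlgebraicClosure ℚ)))) * θI ^ 2) * ψ ρ) ^ e₄) := by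
    intro e₁ e₂ e₃ e₄ σ h₁ h₂ h₃ h₄ hne
    rcases Nat.le_one_iff_eq_zero_or_eq_one.mp h₁ with rfl | rfl <;>
    rcases Nat.le_one_iff_eq_zero_or_eq_one.mp h₂ with rfl | rfl <;>
    rcases Nat.le_one_iff_eq_zero_or_eq_one.mp h₃ with rfl | rfl <;>
    rcases Nat.le_one_iff_eq_zero_or_eq_one.mp h₄ with rfl | rfl <;>
    rcases Int.units_eq_one_or σ with rfl | rfl
    · exact absurd ⟨rfl, rfl, rfl, rfl, rfl⟩ hne
    · exact cert_0000m_n12163 hβ hθI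
    · exact cert_0001p_n12163 hβ hθI
    · exact cert_0001m_n12163 hβ hθI
    · exact cert_0010p_n12163 hβ hθI
    · exact cert_0010m_n12163 hβ hθI
    · exact cert_0011p_n12163 hβ hθI
    · exact cert_0011m_n12163 hβ hθI
    · exact cert_0100p_n12163 hβ hθI
    · exact cert_0100m_n12163 hβ hθI
    · exact cert_0101p_n12163 hβ hθI
    · exact cert_0101m_n12163 hβ hθI
    · exact cert_0110p_n12163 hβ hθI
    · exact cert_0110m_n12163 hβ hθI
    · exact cert_0111p_n12163 hβ hθI
    · exact cert_0111m_n12163 hβ hθI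
    · exact cert_1000p_n12163 hβ hθI
    · exact cert_1000m_n12163 hβ hθI
    · exact cert_1001p_n12163 hβ hθI
    · exact cert_1001m_n12163 hβ hθI
    · exact cert_1010p_n12163 hβ hθI
    · exact cert_1010m_n12163 hβ hθI
    · exact cert_1011p_n12163 hβ hθI
    · exact cert_1011m_n12163 hβ hθI
    · exact cert_1100p_n12163 hβ hθI
    · exact cert_1100m_n12163 hβ hθI
    · exact cert_1101p_n12163 hβ hθI
    · exact cert_1101m_n12163 hβ hθI
    · exact cert_1110p_n12163 hβ hθI
    · exact cert_1110m_n12163 hβ hθI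
    · exact cert_1111p_n12163 hβ hθI
    · exact cert_1111m_n12163 hβ hθI
  exact two_le_classNumberPExp_one_adjoin_of_orderFourCert ((⟨1, 1, 1, -4, -8⟩ : WeierstrassCurve ℤ).baseChange ℚ) not_hasRationalTwoTorsionX_n12163 Δ_n12163_neg hβ hd
    (a₁ := ((-60233 : 𝓞 ↥(IntermediateField.adjoin ℚ ({β} : Set (AlgebraicClosure ℚ)))) + (-36572 : 𝓞 ↥(IntermediateField.adjoin ℚ ({β} : Set (AlgebraicClosure ℚ)))) * θI + (8142 : 𝓞 ↥(IntermediateField.adjoin ℚ ({β} : Set (AlgebraicClosure ℚ)))) * θI ^ 2))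
    (b₁ := ((0 : 𝓞 ↥(IntermediateField.adjoin ℚ ({β} : Set (AlgebraicClosure ℚ)))) + (0 : 𝓞 ↥(IntermediateField.adjoin ℚ ({β} : Set (AlgebraicClosure ℚ)))) * θI + (0 : 𝓞 ↥(IntermediateField.adjoin ℚ ({β} : Set (AlgebraicClosure ℚ)))) * θI ^ 2))
    (c₁ := ((17464080455 : 𝓞 ↥(IntermediateField.adjoin ℚ ({β} : Set (AlgebraicClosure ℚ)))) + (-5988261880 : 𝓞 ↥(IntermediateField.adjoin ℚ ({β} : Set (AlgebraicClosure ℚ)))) * θI + (1398665746 : 𝓞 ↥(IntermediateField.adjoin ℚ ({β} : Set (AlgebraicClosure ℚ)))) * θI ^ 2))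
    (d₁ := ((0 : 𝓞 ↥(IntermediateField.adjoin ℚ ({β} : Set (AlgebraicClosure ℚ)))) + (0 : 𝓞 ↥(IntermediateField.adjoin ℚ ({β} : Set (AlgebraicClosure ℚ)))) * θI + (0 : 𝓞 ↥(IntermediateField.adjoin ℚ ({β} : Set (AlgebraicClosure ℚ)))) * θI ^ 2))
    (a₂ := ((1 : 𝓞 ↥(IntermediateField.adjoin ℚ ({β} : Set (AlgebraicClosure ℚ)))) + (0 : 𝓞 ↥(IntermediateField.adjoin ℚ ({β} : Set (AlgebraicClosure ℚ)))) * θI + (0 : 𝓞 ↥(IntermediateField.adjoin ℚ ({β} : Set (AlgebraicClosure ℚ)))) * θI ^ 2))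
    (b₂ := ((1 : 𝓞 ↥(IntermediateField.adjoin ℚ ({β} : Set (AlgebraicClosure ℚ)))) + (0 : 𝓞 ↥(IntermediateField.adjoin ℚ ({β} : Set (AlgebraicClosure ℚ)))) * θI + (0 : 𝓞 ↥(IntermediateField.adjoin ℚ ({β} : Set (AlgebraicClosure ℚ)))) * θI ^ 2))
    (c₂ := ((-1 : 𝓞 ↥(IntermediateField.adjoin ℚ ({β} : Set (AlgebraicClosure ℚ)))) + (0 : 𝓞 ↥(IntermediateField.adjoin ℚ ({β} : Set (AlgebraicClosure ℚ)))) * θI + (0 : 𝓞 ↥(IntermediateField.adjoin ℚ ({β} : Set (AlgebraicClosure ℚ)))) * θI ^ 2))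
    (d₂ := ((1 : 𝓞 ↥(IntermediateField.adjoin ℚ ({β} : Set (AlgebraicClosure ℚ)))) + (0 : 𝓞 ↥(IntermediateField.adjoin ℚ ({β} : Set (AlgebraicClosure ℚ)))) * θI + (0 : 𝓞 ↥(IntermediateField.adjoin ℚ ({β} : Set (AlgebraicClosure ℚ)))) * θI ^ 2))
    (a₃ := ((-3 : 𝓞 ↥(IntermediateField.adjoin ℚ ({β} : Set (AlgebraicClosure ℚ)))) + (-6 : 𝓞 ↥(IntermediateField.adjoin ℚ ({β} : Set (AlgebraicClosure ℚ)))) * θI + (-30 : 𝓞 ↥(IntermediateField.adjoin ℚ ({β} : Set (AlgebraicClosure ℚ)))) * θI ^ 2))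
    (b₃ := ((38 : 𝓞 ↥(IntermediateField.adjoin ℚ ({β} : Set (AlgebraicClosure ℚ)))) + (-18 : 𝓞 ↥(IntermediateField.adjoin ℚ ({β} : Set (AlgebraicClosure ℚ)))) * θI + (-18 : 𝓞 ↥(IntermediateField.adjoin ℚ ({β} : Set (AlgebraicClosure ℚ)))) * θI ^ 2))
    (c₃ := ((-3 : 𝓞 ↥(IntermediateField.adjoin ℚ ({β} : Set (AlgebraicClosure ℚ)))) + (-6 : 𝓞 ↥(IntermediateField.adjoin ℚ ({β} : Set (AlgebraicClosure ℚ)))) * θI + (-30 : 𝓞 ↥(IntermediateField.adjoin ℚ ({β} : Set (AlgebraicClosure ℚ)))) * θI ^ 2))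
    (d₃ := ((-38 : 𝓞 ↥(IntermediateField.adjoin ℚ ({β} : Set (AlgebraicClosure ℚ)))) + (18 : 𝓞 ↥(IntermediateField.adjoin ℚ ({β} : Set (AlgebraicClosure ℚ)))) * θI + (18 : 𝓞 ↥(IntermediateField.adjoin ℚ ({β} : Set (AlgebraicClosure ℚ)))) * θI ^ 2))
    (A := ((1517 : 𝓞 ↥(IntermediateField.adjoin ℚ ({β} : Set (AlgebraicClosure ℚ)))) + (2118 : 𝓞 ↥(IntermediateField.adjoin ℚ ({β} : Set (AlgebraicClosure ℚ)))) * θI + (729 : 𝓞 ↥(IntermediateField.adjoin ℚ ({β} : Set (AlgebraicClosure ℚ)))) * θI ^ 2))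
    (B := ((1128 : 𝓞 ↥(IntermediateField.adjoin ℚ ({β} : Set (AlgebraicClosure ℚ)))) + (-610 : 𝓞 ↥(IntermediateField.adjoin ℚ ({β} : Set (AlgebraicClosure ℚ)))) * θI + (-1163 : 𝓞 ↥(IntermediateField.adjoin ℚ ({β} : Set (AlgebraicClosure ℚ)))) * θI ^ 2))
    (W₀ := ((225618613 : 𝓞 ↥(IntermediateField.adjoin ℚ ({β} : Set (AlgebraicClosure ℚ)))) + (336753760 : 𝓞 ↥(IntermediateField.adjoin ℚ ({β} : Set (AlgebraicClosure ℚ)))) * θI + (125395599 : 𝓞 ↥(IntermediateField.adjoin ℚ ({β} : Set (AlgebraicClosure ℚ)))) * θI ^ 2))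
    (W₁ := ((-214489672 : 𝓞 ↥(IntermediateField.adjoin ℚ ({β} : Set (AlgebraicClosure ℚ)))) + (82881004 : 𝓞 ↥(IntermediateField.adjoin ℚ ({β} : Set (AlgebraicClosure ℚ)))) * θI + (195305631 : 𝓞 ↥(IntermediateField.adjoin ℚ ({β} : Set (AlgebraicClosure ℚ)))) * θI ^ 2))
    (μ₀ := ((-27964726 : 𝓞 ↥(IntermediateField.adjoin ℚ ({β} : Set (AlgebraicClosure ℚ)))) + (35835710 : 𝓞 ↥(IntermediateField.adjoin ℚ ({β} : Set (AlgebraicClosure ℚ)))) * θI + (-45922460 : 𝓞 ↥(IntermediateField.adjoin ℚ ({β} : Set (AlgebraicClosure ℚ)))) * θI ^ 2))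
    (μ₁ := ((-19804560 : 𝓞 ↥(IntermediateField.adjoin ℚ ({β} : Set (AlgebraicClosure ℚ)))) + (25383112 : 𝓞 ↥(IntermediateField.adjoin ℚ ({β} : Set (AlgebraicClosure ℚ)))) * θI + (-32529861 : 𝓞 ↥(IntermediateField.adjoin ℚ ({β} : Set (AlgebraicClosure ℚ)))) * θI ^ 2))
    (ν₀ := ((9715 : 𝓞 ↥(IntermediateField.adjoin ℚ ({β} : Set (AlgebraicClosure ℚ)))) + (-3059 : 𝓞 ↥(IntermediateField.adjoin ℚ ({β} : Set (AlgebraicClosure ℚ)))) * θI + (688 : 𝓞 ↥(IntermediateField.adjoin ℚ ({β} : Set (AlgebraicClosure ℚ)))) * θI ^ 2))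
    (ν₁ := ((4744 : 𝓞 ↥(IntermediateField.adjoin ℚ ({β} : Set (AlgebraicClosure ℚ)))) + (-1437 : 𝓞 ↥(IntermediateField.adjoin ℚ ({β} : Set (AlgebraicClosure ℚ)))) * θI + (316 : 𝓞 ↥(IntermediateField.adjoin ℚ ({β} : Set (AlgebraicClosure ℚ)))) * θI ^ 2))
    (q₀ := ((1035 : 𝓞 ↥(IntermediateField.adjoin ℚ ({β} : Set (AlgebraicClosure ℚ)))) + (677 : 𝓞 ↥(IntermediateField.adjoin ℚ ({β} : Set (AlgebraicClosure ℚ)))) * θI + (-102 : 𝓞 ↥(IntermediateField.adjoin ℚ ({β} : Set (AlgebraicClosure ℚ)))) * θI ^ 2))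
    (v₀ := ((-3 : 𝓞 ↥(IntermediateField.adjoin ℚ ({β} : Set (AlgebraicClosure ℚ)))) + (0 : 𝓞 ↥(IntermediateField.adjoin ℚ ({β} : Set (AlgebraicClosure ℚ)))) * θI + (0 : 𝓞 ↥(IntermediateField.adjoin ℚ ({β} : Set (AlgebraicClosure ℚ)))) * θI ^ 2))
    (v₁ := ((1 : 𝓞 ↥(IntermediateField.adjoin ℚ ({β} : Set (AlgebraicClosure ℚ)))) + (0 : 𝓞 ↥(IntermediateField.adjoin ℚ ({β} : Set (AlgebraicClosure ℚ)))) * θI + (0 : 𝓞 ↥(IntermediateField.adjoin ℚ ({β} : Set (AlgebraicClosure ℚ)))) * θI ^ 2))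
    (α₀ := ((11 : 𝓞 ↥(IntermediateField.adjoin ℚ ({β} : Set (AlgebraicClosure ℚ)))) + (-46 : 𝓞 ↥(IntermediateField.adjoin ℚ ({β} : Set (AlgebraicClosure ℚ)))) * θI + (77 : 𝓞 ↥(IntermediateField.adjoin ℚ ({β} : Set (AlgebraicClosure ℚ)))) * θI ^ 2))
    (α₁ := ((104 : 𝓞 ↥(IntermediateField.adjoin ℚ ({β} : Set (AlgebraicClosure ℚ)))) + (12 : 𝓞 ↥(IntermediateField.adjoin ℚ ({β} : Set (AlgebraicClosure ℚ)))) * θI + (31 : 𝓞 ↥(IntermediateField.adjoin ℚ ({β} : Set (AlgebraicClosure ℚ)))) * θI ^ 2))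
    (β₀ := ((0 : 𝓞 ↥(IntermediateField.adjoin ℚ ({β} : Set (AlgebraicClosure ℚ)))) + (0 : 𝓞 ↥(IntermediateField.adjoin ℚ ({β} : Set (AlgebraicClosure ℚ)))) * θI + (0 : 𝓞 ↥(IntermediateField.adjoin ℚ ({β} : Set (AlgebraicClosure ℚ)))) * θI ^ 2))
    (β₁ := ((-13 : 𝓞 ↥(IntermediateField.adjoin ℚ ({β} : Set (AlgebraicClosure ℚ)))) + (4 : 𝓞 ↥(IntermediateField.adjoin ℚ ({β} : Set (AlgebraicClosure ℚ)))) * θI + (-1 : 𝓞 ↥(IntermediateField.adjoin ℚ ({β} : Set (AlgebraicClosure ℚ)))) * θI ^ 2))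
    (γ₀ := ((-69920148 : 𝓞 ↥(IntermediateField.adjoin ℚ ({β} : Set (AlgebraicClosure ℚ)))) + (89596980 : 𝓞 ↥(IntermediateField.adjoin ℚ ({β} : Set (AlgebraicClosure ℚ)))) * θI + (-114810203 : 𝓞 ↥(IntermediateField.adjoin ℚ ({β} : Set (AlgebraicClosure ℚ)))) * θI ^ 2))
    (γ₁ := ((-50103727 : 𝓞 ↥(IntermediateField.adjoin ℚ ({β} : Set (AlgebraicClosure ℚ)))) + (64204367 : 𝓞 ↥(IntermediateField.adjoin ℚ ({β} : Set (AlgebraicClosure ℚ)))) * θI + (-82264786 : 𝓞 ↥(IntermediateField.adjoin ℚ ({β} : Set (AlgebraicClosure ℚ)))) * θI ^ 2))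
    (δ₀ := ((179111 : 𝓞 ↥(IntermediateField.adjoin ℚ ({β} : Set (AlgebraicClosure ℚ)))) + (471067 : 𝓞 ↥(IntermediateField.adjoin ℚ ({β} : Set (AlgebraicClosure ℚ)))) * θI + (-6315 : 𝓞 ↥(IntermediateField.adjoin ℚ ({β} : Set (AlgebraicClosure ℚ)))) * θI ^ 2))
    (δ₁ := ((131765 : 𝓞 ↥(IntermediateField.adjoin ℚ ({β} : Set (AlgebraicClosure ℚ)))) + (313850 : 𝓞 ↥(IntermediateField.adjoin ℚ ({β} : Set (AlgebraicClosure ℚ)))) * θI + (59 : 𝓞 ↥(IntermediateField.adjoin ℚ ({β} : Set (AlgebraicClosure ℚ)))) * θI ^ 2))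
    (m₀ := ((38 : 𝓞 ↥(IntermediateField.adjoin ℚ ({β} : Set (AlgebraicClosure ℚ)))) + (-13 : 𝓞 ↥(IntermediateField.adjoin ℚ ({β} : Set (AlgebraicClosure ℚ)))) * θI + (3 : 𝓞 ↥(IntermediateField.adjoin ℚ ({β} : Set (AlgebraicClosure ℚ)))) * θI ^ 2))
    (m₁ := ((26 : 𝓞 ↥(IntermediateField.adjoin ℚ ({β} : Set (AlgebraicClosure ℚ)))) + (-9 : 𝓞 ↥(IntermediateField.adjoin ℚ ({β} : Set (AlgebraicClosure ℚ)))) * θI + (2 : 𝓞 ↥(IntermediateField.adjoin ℚ ({β} : Set (AlgebraicClosure ℚ)))) * θI ^ 2))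
    (n₀ := ((89 : 𝓞 ↥(IntermediateField.adjoin ℚ ({β} : Set (AlgebraicClosure ℚ)))) + (69 : 𝓞 ↥(IntermediateField.adjoin ℚ ({β} : Set (AlgebraicClosure ℚ)))) * θI + (-136 : 𝓞 ↥(IntermediateField.adjoin ℚ ({β} : Set (AlgebraicClosure ℚ)))) * θI ^ 2))
    (n₁ := ((62 : 𝓞 ↥(IntermediateField.adjoin ℚ ({β} : Set (AlgebraicClosure ℚ)))) + (29 : 𝓞 ↥(IntermediateField.adjoin ℚ ({β} : Set (AlgebraicClosure ℚ)))) * θI + (-141 : 𝓞 ↥(IntermediateField.adjoin ℚ ({β} : Set (AlgebraicClosure ℚ)))) * θI ^ 2))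
    (l₀ := ((-64 : 𝓞 ↥(IntermediateField.adjoin ℚ ({β} : Set (AlgebraicClosure ℚ)))) + (9 : 𝓞 ↥(IntermediateField.adjoin ℚ ({β} : Set (AlgebraicClosure ℚ)))) * θI + (46 : 𝓞 ↥(IntermediateField.adjoin ℚ ({β} : Set (AlgebraicClosure ℚ)))) * θI ^ 2))
    (l₁ := ((-37 : 𝓞 ↥(IntermediateField.adjoin ℚ ({β} : Set (AlgebraicClosure ℚ)))) + (-34 : 𝓞 ↥(IntermediateField.adjoin ℚ ({β} : Set (AlgebraicClosure ℚ)))) * θI + (-4 : 𝓞 ↥(IntermediateField.adjoin ℚ ({β} : Set (AlgebraicClosure ℚ)))) * θI ^ 2))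
    (hu1_n12163 hβ hθI) (hu2_n12163 hβ hθI) (hu3_n12163 hβ hθI) (hws_n12163 hβ hθI) (hbez_n12163 hβ hθI) (q0_ne_zero_n12163 hβ hθI)
    (hM2_n12163 hβ hθI) (hM3_n12163 hβ hθI) (hM4_n12163 hβ hθI) hcert κP hκP

end Summit.BirchSwinnertonDyer.BirchSwinnertonDyer.Theorems.AlignedTransportAtTwoCubicOrderFourRowN12163

end
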